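import Literature.NumberTheory.Automorphic.TorusMeasureTowerTransport
import HarnessLib

/-!
# Transport of adelic torus measures along a torus isomorphism that is componentwise in the model tower, II: the product level
(Rogawski (1990) §4.3 pp. 43–44, §14.5 pp. 237–238: the measures `dt = dt_∞ ⊗ ⊗_v dt_v` on the tori `T = G_γ`, `T′ = G′_{γ′}` of
stably conjugate regular elements are compared along the `F`-isomorphism `T ≅ T′`, place by place; Gelbart (1975) p. 155;
Cassels–Fröhlich (1967) Ch. XV (Tate) §3.3: restricted-product measures)

Topic `NumberTheory/Automorphic` (generic layer, as ★ `OrbitalMeasureOfLocalQuotient`); namespace `Literature.NumberTheory.Automorphic`;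
THEOREMS ONLY (no definition, no instance, no named fact).  Registry pub/hodgecm-mathlib F0∕P3a, ENGINE T1 (M-C) «measure coherence»,
row (O10-b3-δ4) of A-p06: the glue under (O-W) «β constant on regular stable classes».

Setting («model tower», twice: sides `1` and `2`).  Finite level: locally compact second countable groups `G_i` with compact open
`K_i`, a model isomorphism `e : G_f ≃ₜ* Πʳ(G_i ; K_i)`, an element `γ ∈ G_f`, Haar-type measures `t_i` on the local centralisers
`C((eγ)_i) ≤ G_i`, and the finite torus measure `t_f` on `C(γ) ≤ G_f` given by the EXPRESSIONS of ★ `orbitalMeasureOfLocal_eq_quotientMeasure`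
(`ρ = cutoutEquiv_* ∏'(t_i ; C ∩ K_i)`, `ρM = ρ` read on `C(eγ)`, `t_f = (e⁻¹|)_* ρM`).  Product level: `e_A : A_∞ × G_f ≃* A`
bicontinuous, `γ_A = e_A(γ_∞, γ)`, the torus measure `t_A = (e_A|)_* t_P` on `C(γ_A)` with `prodEquiv_* t_P = t_∞ ⊗ t_f`
(★ `orbitalMeasureOfProd_quotientMeasure_eq_quotientMeasure`).

* (prequel ★ `TorusMeasureTowerTransport`: §1 `exists_continuousMulEquiv_restrictedProduct_apply_eq`, §2 finite level
  `exists_homeomorph_map_finTorusMeasure_eq`.)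
* §3 `map_torusMeasure_eq_of_prod` — **product level**: a map `P : C(γ¹_A) → C(γ²_A)` which is `(P_∞, P_f)` in the coordinates `e¹_A, e²_A`
  carries `t¹_A` to `t²_A` as soon as `(P_∞)_* t¹_∞ = t²_∞` and `(P_f)_* t¹_f = t²_f`.
* §4 `map_torusMeasure_eq_of_componentwise` — **both levels**: `P_* t¹_A = t²_A` for `P` componentwise `(P_∞, (P_i)_i)`.

With (δ1) ★ `map_eq_of_apply_compactCore_eq_one` (canonical local torus measures are carried to each other by ANY isomorphism) and
★ `covolume_count_eq_of_mulEquiv`, this is the measure-theoretic content of «stably conjugate regular `γ` have the same weight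
`m(Z_γ(L⁺) \ Z_γ(𝔸))`» [Rogawski1990, §14.5 pp. 237–238]; the CM dress (the adelic stable-centraliser isomorphism ★
`adelicStableCentralizerEquiv` IS componentwise) is a separate file.

## References
* J. D. Rogawski, *Automorphic Representations of Unitary Groups in Three Variables* (1990), §4.3 pp. 43–44, §14.5 pp. 237–238 [Rogawski1990].
* S. Gelbart, *Automorphic forms on adele groups* (1975), p. 155 (10.19) [Gelbart1975].
* J. W. S. Cassels, A. Fröhlich (eds.), *Algebraic Number Theory* (1967), Ch. XV (Tate) §3.3 [CasselsFrohlichANT1967].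
-/

set_option autoImplicit false

noncomputable section

open _root_.MeasureTheory _root_.MeasureTheory.Measure Set Filter Function
open _root_.Topology
open Literature.Topology.RestrictedProduct Literature.Topology.Algebra.RestrictedProduct Literature.MeasureTheory.Group
open Literature.MeasureTheory.RestrictedProduct
open scoped RestrictedProduct ENNReal NNReal Pointwise

namespace Literature.NumberTheory.Automorphic

universe u v w

/-! ## §3 Product level: `t_A = (e_A|)_* t_P`, `prodEquiv_* t_P = t_∞ ⊗ t_f` -/

section Prod

variable
  -- side 1
  {A₁ B₁ E₁ : Type*} [Group A₁] [Group B₁] [Group E₁] [TopologicalSpace A₁] [TopologicalSpace B₁] [TopologicalSpace E₁]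
  [MeasurableSpace A₁] [MeasurableSpace B₁] [MeasurableSpace E₁] [BorelSpace A₁] [BorelSpace B₁] [BorelSpace E₁]
  [SecondCountableTopology B₁]
  (eA₁ : A₁ × B₁ ≃* E₁) (heA₁ : Continuous eA₁) (hesA₁ : Continuous eA₁.symm)
  {γ₁ : E₁} {a₁ : A₁} {b₁ : B₁} (hγ₁ : eA₁ (a₁, b₁) = γ₁)
  (ta₁ : Measure (Subgroup.centralizer ({a₁} : Set A₁))) (tb₁ : Measure (Subgroup.centralizer ({b₁} : Set B₁))) [SFinite ta₁] [SFinite tb₁]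
  (tP₁ : Measure ((Subgroup.centralizer ({a₁} : Set A₁)).prod (Subgroup.centralizer ({b₁} : Set B₁))))
  (tA₁ : Measure (Subgroup.centralizer ({γ₁} : Set E₁)))
  -- side 2
  {A₂ B₂ E₂ : Type*} [Group A₂] [Group B₂] [Group E₂] [TopologicalSpace A₂] [TopologicalSpace B₂] [TopologicalSpace E₂]
  [MeasurableSpace A₂] [MeasurableSpace B₂] [MeasurableSpace E₂] [BorelSpace A₂] [BorelSpace B₂] [BorelSpace E₂]
  [SecondCountableTopology B₂]
  (eA₂ : A₂ × B₂ ≃* E₂) (heA₂ : Continuous eA₂) (hesA₂ : Continuous eA₂.symm)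
  {γ₂ : E₂} {a₂ : A₂} {b₂ : B₂} (hγ₂ : eA₂ (a₂, b₂) = γ₂)
  (ta₂ : Measure (Subgroup.centralizer ({a₂} : Set A₂))) (tb₂ : Measure (Subgroup.centralizer ({b₂} : Set B₂)))
  (tP₂ : Measure ((Subgroup.centralizer ({a₂} : Set A₂)).prod (Subgroup.centralizer ({b₂} : Set B₂))))
  (tA₂ : Measure (Subgroup.centralizer ({γ₂} : Set E₂)))

include hesA₁ hesA₂ in
/-- **Product level.**  `t_A = (e_A|_{C(a) × C(b)})_* t_P` with `prodEquiv_* t_P = t_a ⊗ t_b` on both sides (the expressions of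
★ `orbitalMeasureOfProd_quotientMeasure_eq_quotientMeasure`); a map `P : C(γ¹) → C(γ²)` which reads `(P_a, P_b)` in the coordinates
`e¹_A`, `e²_A` (hypotheses `hPa`, `hPb`), for measurable `P_a`, `P_b` with `(P_a)_* t¹_a = t²_a`, `(P_b)_* t¹_b = t²_b`, carries `t¹_A` to
`t²_A`:  `dt′ = dt′_∞ ⊗ dt′_f = (e_∞ × e_f)_* (dt_∞ ⊗ dt_f)`. [cite: Gelbart1975, p. 155 (10.19)] [cite: Rogawski1990, §14.5 pp. 237–238] -/
theorem map_torusMeasure_eq_of_prod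
    (htP₁ : Measure.map (Subgroup.prodEquiv (Subgroup.centralizer ({a₁} : Set A₁)) (Subgroup.centralizer ({b₁} : Set B₁))) tP₁ = ta₁.prod tb₁)
    (htA₁ : tA₁ = Measure.map (subgroupCongrHomeomorph eA₁ _ (Subgroup.centralizer ({γ₁} : Set E₁))
      (forall_apply_mem_centralizer_iff eA₁ hγ₁) heA₁ hesA₁) tP₁)
    (htP₂ : Measure.map (Subgroup.prodEquiv (Subgroup.centralizer ({a₂} : Set A₂)) (Subgroup.centralizer ({b₂} : Set B₂))) tP₂ = ta₂.prod tb₂)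
    (htA₂ : tA₂ = Measure.map (subgroupCongrHomeomorph eA₂ _ (Subgroup.centralizer ({γ₂} : Set E₂))
      (forall_apply_mem_centralizer_iff eA₂ hγ₂) heA₂ hesA₂) tP₂)
    (Pa : Subgroup.centralizer ({a₁} : Set A₁) → Subgroup.centralizer ({a₂} : Set A₂)) (hPam : Measurable Pa)
    (Pb : Subgroup.centralizer ({b₁} : Set B₁) → Subgroup.centralizer ({b₂} : Set B₂)) (hPbm : Measurable Pb)
    (P : Subgroup.centralizer ({γ₁} : Set E₁) → Subgroup.centralizer ({γ₂} : Set E₂))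
    (hPa : ∀ (x : Subgroup.centralizer ({γ₁} : Set E₁)) (hx : (eA₁.symm (x : E₁)).1 ∈ Subgroup.centralizer ({a₁} : Set A₁)),
      (eA₂.symm ((P x : Subgroup.centralizer ({γ₂} : Set E₂)) : E₂)).1 = ((Pa ⟨(eA₁.symm (x : E₁)).1, hx⟩ : Subgroup.centralizer ({a₂} : Set A₂)) : A₂))
    (hPb : ∀ (x : Subgroup.centralizer ({γ₁} : Set E₁)) (hx : (eA₁.symm (x : E₁)).2 ∈ Subgroup.centralizer ({b₁} : Set B₁)),
      (eA₂.symm ((P x : Subgroup.centralizer ({γ₂} : Set E₂)) : E₂)).2 = ((Pb ⟨(eA₁.symm (x : E₁)).2, hx⟩ : Subgroup.centralizer ({b₂} : Set B₂)) : B₂))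
    (ha : Measure.map Pa ta₁ = ta₂) (hb : Measure.map Pb tb₁ = tb₂) :
    Measure.map P tA₁ = tA₂ := by
  -- notation
  set T₁ := subgroupCongrHomeomorph eA₁ _ (Subgroup.centralizer ({γ₁} : Set E₁)) (forall_apply_mem_centralizer_iff eA₁ hγ₁) heA₁ hesA₁ with hT₁
  set T₂ := subgroupCongrHomeomorph eA₂ _ (Subgroup.centralizer ({γ₂} : Set E₂)) (forall_apply_mem_centralizer_iff eA₂ hγ₂) heA₂ hesA₂ with hT₂
  -- `prodEquiv` as measurable equivalences
  have hπm₁ : Measurable (Subgroup.prodEquiv (Subgroup.centralizer ({a₁} : Set A₁)) (Subgroup.centralizer ({b₁} : Set B₁)) : (Subgroup.centralizer ({a₁} : Set A₁)).prod (Subgroup.centralizer ({b₁} : Set B₁)) → (Subgroup.centralizer ({a₁} : Set A₁)) × (Subgroup.centralizer ({b₁} : Set B₁))) :=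
    ((measurable_fst.comp measurable_subtype_coe).subtype_mk).prodMk ((measurable_snd.comp measurable_subtype_coe).subtype_mk)
  have hπm₂ : Measurable (Subgroup.prodEquiv (Subgroup.centralizer ({a₂} : Set A₂)) (Subgroup.centralizer ({b₂} : Set B₂)) : (Subgroup.centralizer ({a₂} : Set A₂)).prod (Subgroup.centralizer ({b₂} : Set B₂)) → (Subgroup.centralizer ({a₂} : Set A₂)) × (Subgroup.centralizer ({b₂} : Set B₂))) :=
    ((measurable_fst.comp measurable_subtype_coe).subtype_mk).prodMk ((measurable_snd.comp measurable_subtype_coe).subtype_mk)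
  have hπsm₂ : Measurable ((Subgroup.prodEquiv (Subgroup.centralizer ({a₂} : Set A₂)) (Subgroup.centralizer ({b₂} : Set B₂))).symm : (Subgroup.centralizer ({a₂} : Set A₂)) × (Subgroup.centralizer ({b₂} : Set B₂)) → (Subgroup.centralizer ({a₂} : Set A₂)).prod (Subgroup.centralizer ({b₂} : Set B₂))) :=
    ((measurable_subtype_coe.comp measurable_fst).prodMk (measurable_subtype_coe.comp measurable_snd)).subtype_mk
  -- `P` is the composite `T₂ ∘ prodEquiv⁻¹ ∘ (P_a × P_b) ∘ prodEquiv ∘ T₁⁻¹`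
  have hPeq : P = fun x => T₂ ((Subgroup.prodEquiv (Subgroup.centralizer ({a₂} : Set A₂)) (Subgroup.centralizer ({b₂} : Set B₂))).symm
      (Prod.map Pa Pb (Subgroup.prodEquiv (Subgroup.centralizer ({a₁} : Set A₁)) (Subgroup.centralizer ({b₁} : Set B₁)) (T₁.symm x)))) := by
    funext x
    set y := T₁.symm x with hy
    have hxy : x = T₁ y := (T₁.apply_symm_apply x).symm
    have hyx : eA₁.symm (x : E₁) = ((y : (Subgroup.centralizer ({a₁} : Set A₁)).prod (Subgroup.centralizer ({b₁} : Set B₁))) : A₁ × B₁) := by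
      rw [hxy]; exact eA₁.symm_apply_apply _
    have hy1 : (eA₁.symm (x : E₁)).1 ∈ (Subgroup.centralizer ({a₁} : Set A₁)) := by rw [hyx]; exact y.2.1
    have hy2 : (eA₁.symm (x : E₁)).2 ∈ (Subgroup.centralizer ({b₁} : Set B₁)) := by rw [hyx]; exact y.2.2
    have h1 : (⟨(eA₁.symm (x : E₁)).1, hy1⟩ : (Subgroup.centralizer ({a₁} : Set A₁))) =
        (Subgroup.prodEquiv (Subgroup.centralizer ({a₁} : Set A₁)) (Subgroup.centralizer ({b₁} : Set B₁)) y).1 :=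
      Subtype.ext (by change (eA₁.symm (x : E₁)).1 = _; rw [hyx]; rfl)
    have h2 : (⟨(eA₁.symm (x : E₁)).2, hy2⟩ : (Subgroup.centralizer ({b₁} : Set B₁))) =
        (Subgroup.prodEquiv (Subgroup.centralizer ({a₁} : Set A₁)) (Subgroup.centralizer ({b₁} : Set B₁)) y).2 :=
      Subtype.ext (by change (eA₁.symm (x : E₁)).2 = _; rw [hyx]; rfl)
    apply Subtype.ext
    change ((P x : Subgroup.centralizer ({γ₂} : Set E₂)) : E₂) =
      eA₂ ((((Subgroup.prodEquiv (Subgroup.centralizer ({a₂} : Set A₂)) (Subgroup.centralizer ({b₂} : Set B₂))).symm (Prod.map Pa Pb (Subgroup.prodEquiv (Subgroup.centralizer ({a₁} : Set A₁)) (Subgroup.centralizer ({b₁} : Set B₁)) y))) : (Subgroup.centralizer ({a₂} : Set A₂)).prod (Subgroup.centralizer ({b₂} : Set B₂))) : A₂ × B₂)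
    rw [← eA₂.apply_symm_apply ((P x : Subgroup.centralizer ({γ₂} : Set E₂)) : E₂)]
    congr 1
    refine Prod.ext ?_ ?_
    · rw [hPa x hy1]
      exact congrArg (fun c : (Subgroup.centralizer ({a₂} : Set A₂)) => (c : A₂)) (congrArg Pa h1)
    · rw [hPb x hy2]
      exact congrArg (fun c : (Subgroup.centralizer ({b₂} : Set B₂)) => (c : B₂)) (congrArg Pb h2)
  have hPm : Measurable P := by
    rw [hPeq]
    exact (Homeomorph.measurable _).comp (hπsm₂.comp ((hPam.prodMap hPbm).comp (hπm₁.comp (Homeomorph.measurable _))))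
  -- push the measures through
  have h1 : Measure.map T₁.symm tA₁ = tP₁ := by
    rw [htA₁, Measure.map_map (Homeomorph.measurable _) (Homeomorph.measurable _), Homeomorph.symm_comp_self, Measure.map_id]
  have h2 : Measure.map (Prod.map Pa Pb) (ta₁.prod tb₁) = ta₂.prod tb₂ := by
    rw [← Measure.map_prod_map _ _ hPam hPbm, ha, hb]
  have h3 : Measure.map (Subgroup.prodEquiv (Subgroup.centralizer ({a₂} : Set A₂)) (Subgroup.centralizer ({b₂} : Set B₂))).symm (ta₂.prod tb₂) = tP₂ := by
    rw [← htP₂, Measure.map_map hπsm₂ hπm₂]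
    have : ((Subgroup.prodEquiv (Subgroup.centralizer ({a₂} : Set A₂)) (Subgroup.centralizer ({b₂} : Set B₂))).symm : (Subgroup.centralizer ({a₂} : Set A₂)) × (Subgroup.centralizer ({b₂} : Set B₂)) → (Subgroup.centralizer ({a₂} : Set A₂)).prod (Subgroup.centralizer ({b₂} : Set B₂))) ∘ (Subgroup.prodEquiv (Subgroup.centralizer ({a₂} : Set A₂)) (Subgroup.centralizer ({b₂} : Set B₂))) = id :=
      funext fun z => (Subgroup.prodEquiv (Subgroup.centralizer ({a₂} : Set A₂)) (Subgroup.centralizer ({b₂} : Set B₂))).symm_apply_apply z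
    rw [this, Measure.map_id]
  rw [hPeq]
  change Measure.map (⇑T₂ ∘ (⇑(Subgroup.prodEquiv (Subgroup.centralizer ({a₂} : Set A₂)) (Subgroup.centralizer ({b₂} : Set B₂))).symm ∘
    (Prod.map Pa Pb ∘ (⇑(Subgroup.prodEquiv (Subgroup.centralizer ({a₁} : Set A₁)) (Subgroup.centralizer ({b₁} : Set B₁))) ∘ ⇑T₁.symm)))) tA₁ = tA₂
  rw [← Measure.map_map (Homeomorph.measurable _) (hπsm₂.comp ((hPam.prodMap hPbm).comp (hπm₁.comp (Homeomorph.measurable _)))),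
    ← Measure.map_map hπsm₂ ((hPam.prodMap hPbm).comp (hπm₁.comp (Homeomorph.measurable _))),
    ← Measure.map_map (hPam.prodMap hPbm) (hπm₁.comp (Homeomorph.measurable _)),
    ← Measure.map_map hπm₁ (Homeomorph.measurable _), h1, htP₁, h2, h3, htA₂]

end Prod

/-! ## §4 Both levels: a torus isomorphism componentwise in the model tower carries `t_A` to `t_A′` -/

section Both

variable {ι : Type u} [Countable ι]
  -- side 1, finite level
  {G₁ : ι → Type v} [∀ i, Group (G₁ i)] [∀ i, TopologicalSpace (G₁ i)] [∀ i, IsTopologicalGroup (G₁ i)]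
  [∀ i, SecondCountableTopology (G₁ i)] [∀ i, T2Space (G₁ i)]
  [∀ i, MeasurableSpace (G₁ i)] [∀ i, BorelSpace (G₁ i)]
  (K₁ : ∀ i, Subgroup (G₁ i)) [hK₁o : Fact (∀ i, IsOpen (K₁ i : Set (G₁ i)))] [hK₁c : ∀ i, CompactSpace (K₁ i)]
  [BorelSpace (Πʳ i, [G₁ i, K₁ i])]
  {Gf₁ : Type*} [Group Gf₁] [TopologicalSpace Gf₁] [MeasurableSpace Gf₁] [BorelSpace Gf₁] [SecondCountableTopology Gf₁]
  (e₁ : Gf₁ ≃ₜ* (Πʳ i, [G₁ i, K₁ i])) (γ₁ : Gf₁)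
  [hC₁ : ∀ i, IsClosed ((Subgroup.centralizer ({e₁ γ₁ i} : Set (G₁ i)) : Subgroup (G₁ i)) : Set (G₁ i))]
  (t₁ : ∀ i, Measure (Subgroup.centralizer ({e₁ γ₁ i} : Set (G₁ i)))) [∀ i, (t₁ i).IsMulLeftInvariant]
  [∀ i, IsFiniteMeasureOnCompacts (t₁ i)] [∀ i, (t₁ i).IsOpenPosMeasure] [∀ i, SigmaFinite (t₁ i)]
  (S₁ : Finset ι)
  (ρ₁ : Measure (cutout K₁ (fun i => Subgroup.centralizer ({e₁ γ₁ i} : Set (G₁ i))) : Subgroup (Πʳ i, [G₁ i, K₁ i])))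
  (ρM₁ : Measure (Subgroup.centralizer ({e₁ γ₁} : Set (Πʳ i, [G₁ i, K₁ i]))))
  (tf₁ : Measure (Subgroup.centralizer ({γ₁} : Set Gf₁))) [SFinite tf₁]
  -- side 1, product level
  {A₁ E₁ : Type*} [Group A₁] [Group E₁] [TopologicalSpace A₁] [TopologicalSpace E₁]
  [MeasurableSpace A₁] [MeasurableSpace E₁] [BorelSpace A₁] [BorelSpace E₁]
  (eA₁ : A₁ × Gf₁ ≃* E₁) (heA₁ : Continuous eA₁) (hesA₁ : Continuous eA₁.symm)
  {g₁ : E₁} {a₁ : A₁} (hg₁ : eA₁ (a₁, γ₁) = g₁)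
  (ta₁ : Measure (Subgroup.centralizer ({a₁} : Set A₁))) [SFinite ta₁]
  (tP₁ : Measure ((Subgroup.centralizer ({a₁} : Set A₁)).prod (Subgroup.centralizer ({γ₁} : Set Gf₁))))
  (tA₁ : Measure (Subgroup.centralizer ({g₁} : Set E₁)))
  -- side 2, finite level
  {G₂ : ι → Type w} [∀ i, Group (G₂ i)] [∀ i, TopologicalSpace (G₂ i)] [∀ i, IsTopologicalGroup (G₂ i)]
  [∀ i, SecondCountableTopology (G₂ i)] [∀ i, T2Space (G₂ i)]
  [∀ i, MeasurableSpace (G₂ i)] [∀ i, BorelSpace (G₂ i)]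
  (K₂ : ∀ i, Subgroup (G₂ i)) [hK₂o : Fact (∀ i, IsOpen (K₂ i : Set (G₂ i)))] [hK₂c : ∀ i, CompactSpace (K₂ i)]
  [BorelSpace (Πʳ i, [G₂ i, K₂ i])]
  {Gf₂ : Type*} [Group Gf₂] [TopologicalSpace Gf₂] [MeasurableSpace Gf₂] [BorelSpace Gf₂] [SecondCountableTopology Gf₂]
  (e₂ : Gf₂ ≃ₜ* (Πʳ i, [G₂ i, K₂ i])) (γ₂ : Gf₂)
  [hC₂ : ∀ i, IsClosed ((Subgroup.centralizer ({e₂ γ₂ i} : Set (G₂ i)) : Subgroup (G₂ i)) : Set (G₂ i))]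
  (t₂ : ∀ i, Measure (Subgroup.centralizer ({e₂ γ₂ i} : Set (G₂ i)))) [∀ i, (t₂ i).IsMulLeftInvariant]
  [∀ i, IsFiniteMeasureOnCompacts (t₂ i)] [∀ i, (t₂ i).IsOpenPosMeasure] [∀ i, SigmaFinite (t₂ i)]
  (S₂ : Finset ι)
  (ρ₂ : Measure (cutout K₂ (fun i => Subgroup.centralizer ({e₂ γ₂ i} : Set (G₂ i))) : Subgroup (Πʳ i, [G₂ i, K₂ i])))
  (ρM₂ : Measure (Subgroup.centralizer ({e₂ γ₂} : Set (Πʳ i, [G₂ i, K₂ i]))))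
  (tf₂ : Measure (Subgroup.centralizer ({γ₂} : Set Gf₂)))
  -- side 2, product level
  {A₂ E₂ : Type*} [Group A₂] [Group E₂] [TopologicalSpace A₂] [TopologicalSpace E₂]
  [MeasurableSpace A₂] [MeasurableSpace E₂] [BorelSpace A₂] [BorelSpace E₂]
  (eA₂ : A₂ × Gf₂ ≃* E₂) (heA₂ : Continuous eA₂) (hesA₂ : Continuous eA₂.symm)
  {g₂ : E₂} {a₂ : A₂} (hg₂ : eA₂ (a₂, γ₂) = g₂)
  (ta₂ : Measure (Subgroup.centralizer ({a₂} : Set A₂)))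
  (tP₂ : Measure ((Subgroup.centralizer ({a₂} : Set A₂)).prod (Subgroup.centralizer ({γ₂} : Set Gf₂))))
  (tA₂ : Measure (Subgroup.centralizer ({g₂} : Set E₂)))

include hesA₁ hesA₂ in
/-- **Both levels: `P_* t_A = t′_A` for a torus map `P : C(g) → C(g′)` which is componentwise in the model tower** — `(P_∞, (P_i)_i)`
in the coordinates `e_A`, `e` (hypotheses `hPa`, `hPloc`) — as soon as `(P_∞)_* t_∞ = t′_∞` (hypothesis `ha`; measurable `P_∞`) and the
local isomorphisms `P_i` carry `t_i` to `t′_i` (`ht`) and respect the integral structure off a finite set (`hPK`).  The torus measures are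
the EXPRESSIONS `t_A = (e_A|)_* t_P`, `prodEquiv_* t_P = t_∞ ⊗ t_f`, `t_f = (e⁻¹|)_* ((cutoutEquiv_* ∏'(t_i ; C ∩ K_i))` read on `C(eγ)`)`
of ★ `orbitalMeasureOfProd_quotientMeasure_eq_quotientMeasure` ∕ ★ `orbitalMeasureOfLocal_eq_quotientMeasure` on both sides.  This is
`dt′ = e_* dt` for `dt = dt_∞ ⊗ ⊗_v dt_v`, `dt′ = dt′_∞ ⊗ ⊗_v dt′_v`, `e = (e_∞, (e_v)_v)`. [cite: Rogawski1990, §14.5 pp. 237–238]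
[cite: Gelbart1975, p. 155 (10.19)] [cite: CasselsFrohlichANT1967, Ch. XV (Tate) §3.3] -/
theorem map_torusMeasure_eq_of_componentwise
    -- finite towers
    (ht1₁ : ∀ i, i ∉ S₁ → t₁ i ((inH K₁ (fun i => Subgroup.centralizer ({e₁ γ₁ i} : Set (G₁ i))) i :
      Subgroup (Subgroup.centralizer ({e₁ γ₁ i} : Set (G₁ i)))) : Set (Subgroup.centralizer ({e₁ γ₁ i} : Set (G₁ i)))) = 1)
    (hρ₁ : ρ₁ = Measure.map (cutoutEquiv K₁ (fun i => Subgroup.centralizer ({e₁ γ₁ i} : Set (G₁ i))))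
      (rpMeasure (fun i => ((inH K₁ (fun i => Subgroup.centralizer ({e₁ γ₁ i} : Set (G₁ i))) i :
        Subgroup (Subgroup.centralizer ({e₁ γ₁ i} : Set (G₁ i)))) : Set (Subgroup.centralizer ({e₁ γ₁ i} : Set (G₁ i))))) t₁ S₁))
    (hρM₁ : ρM₁ = Measure.map (subgroupCongrHomeomorph (MulEquiv.refl (Πʳ i, [G₁ i, K₁ i]))
      (cutout K₁ (fun i => Subgroup.centralizer ({e₁ γ₁ i} : Set (G₁ i)))) (Subgroup.centralizer ({e₁ γ₁} : Set (Πʳ i, [G₁ i, K₁ i])))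
      (forall_refl_mem_iff K₁ (fun i => Subgroup.centralizer ({e₁ γ₁ i} : Set (G₁ i))) _
        (mem_centralizer_singleton_iff_forall_mem K₁ (e₁ γ₁)))
      continuous_id continuous_id) ρ₁)
    (htf₁ : tf₁ = Measure.map (subgroupCongrHomeomorph e₁.symm.toMulEquiv (Subgroup.centralizer ({e₁ γ₁} : Set (Πʳ i, [G₁ i, K₁ i])))
      (Subgroup.centralizer ({γ₁} : Set Gf₁)) (forall_apply_mem_centralizer_singleton_iff_of_eq e₁.symm.toMulEquiv (e₁.symm_apply_apply γ₁))
      e₁.symm.continuous e₁.continuous) ρM₁)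
    (ht1₂ : ∀ i, i ∉ S₂ → t₂ i ((inH K₂ (fun i => Subgroup.centralizer ({e₂ γ₂ i} : Set (G₂ i))) i :
      Subgroup (Subgroup.centralizer ({e₂ γ₂ i} : Set (G₂ i)))) : Set (Subgroup.centralizer ({e₂ γ₂ i} : Set (G₂ i)))) = 1)
    (hρ₂ : ρ₂ = Measure.map (cutoutEquiv K₂ (fun i => Subgroup.centralizer ({e₂ γ₂ i} : Set (G₂ i))))
      (rpMeasure (fun i => ((inH K₂ (fun i => Subgroup.centralizer ({e₂ γ₂ i} : Set (G₂ i))) i :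
        Subgroup (Subgroup.centralizer ({e₂ γ₂ i} : Set (G₂ i)))) : Set (Subgroup.centralizer ({e₂ γ₂ i} : Set (G₂ i))))) t₂ S₂))
    (hρM₂ : ρM₂ = Measure.map (subgroupCongrHomeomorph (MulEquiv.refl (Πʳ i, [G₂ i, K₂ i]))
      (cutout K₂ (fun i => Subgroup.centralizer ({e₂ γ₂ i} : Set (G₂ i)))) (Subgroup.centralizer ({e₂ γ₂} : Set (Πʳ i, [G₂ i, K₂ i])))
      (forall_refl_mem_iff K₂ (fun i => Subgroup.centralizer ({e₂ γ₂ i} : Set (G₂ i))) _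
        (mem_centralizer_singleton_iff_forall_mem K₂ (e₂ γ₂)))
      continuous_id continuous_id) ρ₂)
    (htf₂ : tf₂ = Measure.map (subgroupCongrHomeomorph e₂.symm.toMulEquiv (Subgroup.centralizer ({e₂ γ₂} : Set (Πʳ i, [G₂ i, K₂ i])))
      (Subgroup.centralizer ({γ₂} : Set Gf₂)) (forall_apply_mem_centralizer_singleton_iff_of_eq e₂.symm.toMulEquiv (e₂.symm_apply_apply γ₂))
      e₂.symm.continuous e₂.continuous) ρM₂)
    -- product towers
    (htP₁ : Measure.map (Subgroup.prodEquiv (Subgroup.centralizer ({a₁} : Set A₁)) (Subgroup.centralizer ({γ₁} : Set Gf₁))) tP₁ = ta₁.prod tf₁)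
    (htA₁ : tA₁ = Measure.map (subgroupCongrHomeomorph eA₁ _ (Subgroup.centralizer ({g₁} : Set E₁))
      (forall_apply_mem_centralizer_iff eA₁ hg₁) heA₁ hesA₁) tP₁)
    (htP₂ : Measure.map (Subgroup.prodEquiv (Subgroup.centralizer ({a₂} : Set A₂)) (Subgroup.centralizer ({γ₂} : Set Gf₂))) tP₂ = ta₂.prod tf₂)
    (htA₂ : tA₂ = Measure.map (subgroupCongrHomeomorph eA₂ _ (Subgroup.centralizer ({g₂} : Set E₂))
      (forall_apply_mem_centralizer_iff eA₂ hg₂) heA₂ hesA₂) tP₂)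
    -- the local and archimedean isomorphisms and their effect on the measures
    (P : ∀ i, Subgroup.centralizer ({e₁ γ₁ i} : Set (G₁ i)) ≃ₜ* Subgroup.centralizer ({e₂ γ₂ i} : Set (G₂ i)))
    (hPK : ∀ᶠ i in cofinite, ∀ c : Subgroup.centralizer ({e₁ γ₁ i} : Set (G₁ i)),
      ((P i c : Subgroup.centralizer ({e₂ γ₂ i} : Set (G₂ i))) : G₂ i) ∈ K₂ i ↔ (c : G₁ i) ∈ K₁ i)
    (ht : ∀ i, Measure.map (P i) (t₁ i) = t₂ i)
    (Pa : Subgroup.centralizer ({a₁} : Set A₁) → Subgroup.centralizer ({a₂} : Set A₂)) (hPam : Measurable Pa)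
    (ha : Measure.map Pa ta₁ = ta₂)
    -- the global map and its components
    (Pg : Subgroup.centralizer ({g₁} : Set E₁) → Subgroup.centralizer ({g₂} : Set E₂))
    (hPa : ∀ (x : Subgroup.centralizer ({g₁} : Set E₁)) (hx : (eA₁.symm (x : E₁)).1 ∈ Subgroup.centralizer ({a₁} : Set A₁)),
      (eA₂.symm ((Pg x : Subgroup.centralizer ({g₂} : Set E₂)) : E₂)).1 =
        ((Pa ⟨(eA₁.symm (x : E₁)).1, hx⟩ : Subgroup.centralizer ({a₂} : Set A₂)) : A₂))
    (hPloc : ∀ (x : Subgroup.centralizer ({g₁} : Set E₁)) (i : ι)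
      (hx : e₁ (eA₁.symm (x : E₁)).2 i ∈ Subgroup.centralizer ({e₁ γ₁ i} : Set (G₁ i))),
      e₂ (eA₂.symm ((Pg x : Subgroup.centralizer ({g₂} : Set E₂)) : E₂)).2 i =
        ((P i ⟨e₁ (eA₁.symm (x : E₁)).2 i, hx⟩ : Subgroup.centralizer ({e₂ γ₂ i} : Set (G₂ i))) : G₂ i)) :
    Measure.map Pg tA₁ = tA₂ := by
  obtain ⟨Pf, hPf, hf⟩ := exists_homeomorph_map_finTorusMeasure_eq K₁ e₁ γ₁ t₁ S₁ ρ₁ ρM₁ tf₁ K₂ e₂ γ₂ t₂ S₂ ρ₂ ρM₂ tf₂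
    ht1₁ hρ₁ hρM₁ htf₁ ht1₂ hρ₂ hρM₂ htf₂ P hPK ht
  refine map_torusMeasure_eq_of_prod eA₁ heA₁ hesA₁ hg₁ ta₁ tf₁ tP₁ tA₁ eA₂ heA₂ hesA₂ hg₂ ta₂ tf₂ tP₂ tA₂ htP₁ htA₁ htP₂ htA₂
    Pa hPam Pf Pf.measurable Pg hPa (fun x hx => ?_) ha hf
  -- the finite component of `Pg x` is `P_f` of the finite component of `x`: check after `e₂`, componentwise
  apply e₂.injective
  ext i
  have hx' : ∀ i, e₁ (eA₁.symm (x : E₁)).2 i ∈ Subgroup.centralizer ({e₁ γ₁ i} : Set (G₁ i)) := fun i =>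
    (mem_centralizer_singleton_iff_forall_mem K₁ (e₁ γ₁) _).1
      ((forall_apply_mem_centralizer_singleton_iff_of_eq e₁.toMulEquiv rfl _).2 hx) i
  rw [hPloc x i (hx' i)]
  exact (hPf ⟨(eA₁.symm (x : E₁)).2, hx⟩ i (hx' i)).symm

end Both

end Literature.NumberTheory.Automorphic
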